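import Literature.Probability.FitznerVanDerHofstad2017.BlockSummationRight

/-!
# [FvdH17] §5.3 / §6.2.1: the summed diagrammatic bounds as REAL numbers — the `[0,∞] → ℝ` bridge, PROVED

Source: R. Fitzner, R. van der Hofstad, *Mean-field behavior for nearest-neighbor percolation in `d > 10`*,
Electron. J. Probab. **22** (2017) no. 43 [FvdH17]; page and equation numbers are those of the extended version
arXiv:1506.07977v2.  Prop. 5.5 (5.34) (p. 53) bounds the real number `Σ_x Ξ^{(N)}(x)` by `P⃗^S B^{N−1} Ā^{[F]} P⃗^E`;
Lemma 6.1 (6.51) (p. 66) with (6.48)–(6.50) gives, after "a split as demonstrated in (6.5)" (p. 67), the two-sided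
form `Σ_x Ξ^{(N)}(x) ≤ P⃗^S B^M Ā (B̄)^m P⃗^E` (`M + m = N − 1`); the notebook [FvdHnb] `Percolation.nb` evaluates these
as products of real `3 × 3` matrices and sums the `N`-tails through `Eigensystem[Matrix[B,s]]`, `Eigensystem[Matrix[Bbar,s]]`.

The modules `BlockSummation`, `BlockSummationRight` prove these summations over `[0, ∞]`-valued kernels (where
Tonelli is unconditional).  The tree's tail machinery (`EigenTails.tailTerm φ u B p M B̄ q w = φ • u ⬝ᵥ ((B^p * M * B̄^q)
*ᵥ w)`) is over REAL matrices.  This module is the bridge, all kernel-proved, nothing cited as a hypothesis: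
* `tsum_le_dotProduct_mulVec` — the two-sided bound of `BlockSummationRight` in the shape
  `Σ_x Ξ(x) ≤ P⃗S ⬝ᵥ ((B^M * Ā * (matBR B̄)^m) *ᵥ P⃗E)` (still in `[0, ∞]`);
* finiteness lemmas `vecMul_ne_top`, `mulVec_ne_top`, `dotProduct_ne_top`, `mul_apply_ne_top`, `pow_apply_ne_top` and
  the entrywise `toReal` maps `toReal_dotProduct`, `toReal_vecMul`, `toReal_mulVec`, `map_toReal_mul`, `map_toReal_pow`
  for vectors / matrices with finite entries [folklore];
* `summable_toReal_and_tsum_le` — if `Σ_x Ξ(x) ≤ u ⬝ᵥ ((B^M * A * B̄^m) *ᵥ w)` in `[0, ∞]` and all entries of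
  `u, B, A, B̄, w` are finite, then `x ↦ (Ξ x).toReal` is summable and
  `Σ_x (Ξ x).toReal ≤ uℝ ⬝ᵥ ((Bℝ^M * Aℝ * B̄ℝ^m) *ᵥ wℝ)` with `Xℝ` the entrywise `toReal`;
* `tsum_toReal_le_of_xSpaceBound` — the two combined: from the (6.51)-shaped `x`-space hypothesis and finiteness of the
  entries of `P⃗S, P⃗E, matB B, matAbar Ā, matBR B̄`, the REAL inequality
  `Σ_x (Ξ x).toReal ≤ P⃗Sℝ ⬝ᵥ (((matB B)ℝ^M * (matAbar Ā)ℝ * (matBR B̄)ℝ^m) *ᵥ P⃗Eℝ)` together with summability.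
Abstract setting as in the sibling modules; no block of §5.1 is defined and no number is produced.
-/

noncomputable section

namespace Literature.Probability.FitznerVanDerHofstad2017.BlockSummation

open scoped ENNReal Matrix
open Matrix

section Reshape

variable {G ι K : Type*}

/-- The two-sided summed bound of `BlockSummationRight.tsum_le_vecMul_pow_mul_pow_mulVec` in the shape used by the
tree's tail terms: `Σ_x Ξ(x) ≤ P⃗S ⬝ᵥ ((B^M * Ā * (matBR B̄)^m) *ᵥ P⃗E)`.
[cite: FitznerVanDerHofstad2017, Lemma 6.1 (6.51) and §6.2.1 (arXiv:1506.07977v2 pp. 65–67)] -/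
theorem tsum_le_dotProduct_mulVec [AddCommGroup G] [Fintype ι] [DecidableEq ι] [Fintype K]
    {B A Bb : K → ι → ι → G → G → G → G → ℝ≥0∞} (hB : ∀ κ a b, IsTransInv (B κ a b))
    (hA : ∀ κ a b, IsTransInv (A κ a b)) (hBb : ∀ κ a b, IsTransInv (Bb κ a b)) (Ξ : G → ℝ≥0∞)
    (PS PE : ι → G → G → ℝ≥0∞) (M m : ℕ)
    (hΞ : ∀ x, Ξ x ≤ ∑' u, ∑' w, ∑' t, ∑' z, ∑ κ, ∑ a, ∑ b,
      recP PS B M a u w * A κ a b u w t z * recR PE Bb m b (z - x) (t - x)) :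
    ∑' x, Ξ x ≤ vecP PS ⬝ᵥ ((matB B ^ M * matAbar A * matBR Bb ^ m) *ᵥ vecP PE) := by
  refine (tsum_le_vecMul_pow_mul_pow_mulVec hB hA hBb Ξ PS PE M m hΞ).trans_eq ?_
  simp only [Matrix.dotProduct_mulVec, ← Matrix.vecMul_vecMul]

end Reshape

section RealBridge

variable {ι : Type*} [Fintype ι]

/-- A finite sum of products of finite entries is finite: `(v ᵥ* M) b ≠ ∞`. [folklore] -/
theorem vecMul_ne_top {v : ι → ℝ≥0∞} {M : Matrix ι ι ℝ≥0∞} (hv : ∀ a, v a ≠ ∞) (hM : ∀ a b, M a b ≠ ∞)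
    (b : ι) : (v ᵥ* M) b ≠ ∞ := by
  show ∑ a, v a * M a b ≠ ∞
  exact ENNReal.sum_ne_top.2 fun a _ => ENNReal.mul_ne_top (hv a) (hM a b)

/-- `(M *ᵥ w) a ≠ ∞` for finite entries. [folklore] -/
theorem mulVec_ne_top {M : Matrix ι ι ℝ≥0∞} {w : ι → ℝ≥0∞} (hM : ∀ a b, M a b ≠ ∞) (hw : ∀ b, w b ≠ ∞)
    (a : ι) : (M *ᵥ w) a ≠ ∞ := by
  show ∑ b, M a b * w b ≠ ∞
  exact ENNReal.sum_ne_top.2 fun b _ => ENNReal.mul_ne_top (hM a b) (hw b)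

/-- `v ⬝ᵥ w ≠ ∞` for finite entries. [folklore] -/
theorem dotProduct_ne_top {v w : ι → ℝ≥0∞} (hv : ∀ a, v a ≠ ∞) (hw : ∀ a, w a ≠ ∞) : v ⬝ᵥ w ≠ ∞ :=
  ENNReal.sum_ne_top.2 fun a _ => ENNReal.mul_ne_top (hv a) (hw a)

/-- `(M * N) a b ≠ ∞` for finite entries. [folklore] -/
theorem mul_apply_ne_top {M N : Matrix ι ι ℝ≥0∞} (hM : ∀ a b, M a b ≠ ∞) (hN : ∀ a b, N a b ≠ ∞) (a b : ι) :
    (M * N) a b ≠ ∞ := by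
  rw [Matrix.mul_apply]
  exact ENNReal.sum_ne_top.2 fun c _ => ENNReal.mul_ne_top (hM a c) (hN c b)

/-- `(M ^ k) a b ≠ ∞` for finite entries. [folklore] -/
theorem pow_apply_ne_top [DecidableEq ι] {M : Matrix ι ι ℝ≥0∞} (hM : ∀ a b, M a b ≠ ∞) :
    ∀ (k : ℕ) (a b : ι), (M ^ k) a b ≠ ∞
  | 0, a, b => by
      rw [pow_zero, Matrix.one_apply]
      split_ifs <;> simp
  | k + 1, a, b => by
      rw [pow_succ]
      exact mul_apply_ne_top (pow_apply_ne_top hM k) hM a b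

/-- `toReal` of a dot product of finite vectors. [folklore] -/
theorem toReal_dotProduct {v w : ι → ℝ≥0∞} (hv : ∀ a, v a ≠ ∞) (hw : ∀ a, w a ≠ ∞) :
    (v ⬝ᵥ w).toReal = (fun a => (v a).toReal) ⬝ᵥ fun a => (w a).toReal := by
  show (∑ a, v a * w a).toReal = ∑ a, (v a).toReal * (w a).toReal
  rw [ENNReal.toReal_sum fun a _ => ENNReal.mul_ne_top (hv a) (hw a)]
  simp only [ENNReal.toReal_mul]

/-- `toReal` of `v ᵥ* M` for finite entries is `vℝ ᵥ* Mℝ`. [folklore] -/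
theorem toReal_vecMul {v : ι → ℝ≥0∞} {M : Matrix ι ι ℝ≥0∞} (hv : ∀ a, v a ≠ ∞) (hM : ∀ a b, M a b ≠ ∞) :
    (fun b => ((v ᵥ* M) b).toReal) = (fun a => (v a).toReal) ᵥ* M.map ENNReal.toReal := by
  funext b
  show (∑ a, v a * M a b).toReal = ∑ a, (v a).toReal * (M a b).toReal
  rw [ENNReal.toReal_sum fun a _ => ENNReal.mul_ne_top (hv a) (hM a b)]
  simp only [ENNReal.toReal_mul]

/-- `toReal` of `M *ᵥ w` for finite entries is `Mℝ *ᵥ wℝ`. [folklore] -/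
theorem toReal_mulVec {M : Matrix ι ι ℝ≥0∞} {w : ι → ℝ≥0∞} (hM : ∀ a b, M a b ≠ ∞) (hw : ∀ b, w b ≠ ∞) :
    (fun a => ((M *ᵥ w) a).toReal) = M.map ENNReal.toReal *ᵥ fun b => (w b).toReal := by
  funext a
  show (∑ b, M a b * w b).toReal = ∑ b, (M a b).toReal * (w b).toReal
  rw [ENNReal.toReal_sum fun b _ => ENNReal.mul_ne_top (hM a b) (hw b)]
  simp only [ENNReal.toReal_mul]

/-- Entrywise `toReal` is multiplicative on matrices with finite entries. [folklore] -/
theorem map_toReal_mul {M N : Matrix ι ι ℝ≥0∞} (hM : ∀ a b, M a b ≠ ∞) (hN : ∀ a b, N a b ≠ ∞) :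
    (M * N).map ENNReal.toReal = M.map ENNReal.toReal * N.map ENNReal.toReal := by
  ext a b
  rw [Matrix.map_apply, Matrix.mul_apply, Matrix.mul_apply,
    ENNReal.toReal_sum fun c _ => ENNReal.mul_ne_top (hM a c) (hN c b)]
  simp only [Matrix.map_apply, ENNReal.toReal_mul]

/-- Entrywise `toReal` commutes with powers of a matrix with finite entries. [folklore] -/
theorem map_toReal_pow [DecidableEq ι] {M : Matrix ι ι ℝ≥0∞} (hM : ∀ a b, M a b ≠ ∞) :
    ∀ k : ℕ, (M ^ k).map ENNReal.toReal = M.map ENNReal.toReal ^ k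
  | 0 => by rw [pow_zero, pow_zero, Matrix.map_one ENNReal.toReal ENNReal.toReal_zero ENNReal.toReal_one]
  | k + 1 => by rw [pow_succ, map_toReal_mul (pow_apply_ne_top hM k) hM, map_toReal_pow hM k, pow_succ]

/-- **The bridge.** If `Σ_x Ξ(x) ≤ u ⬝ᵥ ((B^M * A * B̄^m) *ᵥ w)` in `[0, ∞]` and all entries of `u, B, A, B̄, w` are
finite, then `x ↦ (Ξ x).toReal` is summable and `Σ_x (Ξ x).toReal ≤ uℝ ⬝ᵥ ((Bℝ^M * Aℝ * B̄ℝ^m) *ᵥ wℝ)`, where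
`Xℝ` denotes the entrywise `toReal` (the shape of the tree's `EigenTails.tailTerm`).
[cite: FitznerVanDerHofstad2017, Prop. 5.5 (5.34) and Lemma 6.1 (6.51) (arXiv:1506.07977v2 pp. 53, 66): the bounds are real numbers] -/
theorem summable_toReal_and_tsum_le [DecidableEq ι] {α : Type*} {Ξ : α → ℝ≥0∞} {u w : ι → ℝ≥0∞}
    {B A Bb : Matrix ι ι ℝ≥0∞} (hu : ∀ a, u a ≠ ∞) (hw : ∀ b, w b ≠ ∞) (hB : ∀ a b, B a b ≠ ∞)
    (hA : ∀ a b, A a b ≠ ∞) (hBb : ∀ a b, Bb a b ≠ ∞) (M m : ℕ)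
    (h : ∑' x, Ξ x ≤ u ⬝ᵥ ((B ^ M * A * Bb ^ m) *ᵥ w)) :
    Summable (fun x => (Ξ x).toReal) ∧
      ∑' x, (Ξ x).toReal ≤ (fun a => (u a).toReal) ⬝ᵥ
        ((B.map ENNReal.toReal ^ M * A.map ENNReal.toReal * Bb.map ENNReal.toReal ^ m) *ᵥ
          fun b => (w b).toReal) := by
  have hmat : ∀ a b, (B ^ M * A * Bb ^ m) a b ≠ ∞ :=
    mul_apply_ne_top (mul_apply_ne_top (pow_apply_ne_top hB M) hA) (pow_apply_ne_top hBb m)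
  have hfin : u ⬝ᵥ ((B ^ M * A * Bb ^ m) *ᵥ w) ≠ ∞ := dotProduct_ne_top hu (mulVec_ne_top hmat hw)
  have htsum : ∑' x, Ξ x ≠ ∞ := ne_top_of_le_ne_top hfin h
  have hΞ : ∀ x, Ξ x ≠ ∞ := fun x => ne_top_of_le_ne_top htsum (ENNReal.le_tsum x)
  refine ⟨ENNReal.summable_toReal htsum, ?_⟩
  rw [← ENNReal.tsum_toReal_eq hΞ]
  refine (ENNReal.toReal_mono hfin h).trans_eq ?_
  rw [toReal_dotProduct hu (mulVec_ne_top hmat hw), toReal_mulVec hmat hw,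
    map_toReal_mul (mul_apply_ne_top (pow_apply_ne_top hB M) hA) (pow_apply_ne_top hBb m),
    map_toReal_mul (pow_apply_ne_top hB M) hA, map_toReal_pow hB M, map_toReal_pow hBb m]

end RealBridge

section RealBound

variable {G ι K : Type*}

/-- **Lemma 6.1 summed, as a real inequality.** From the (6.51)-shaped `x`-space hypothesis (left piece
`P^{(M)} = recP PS B M`, junction `Ā`, right piece `R^{(m)} = recR PE B̄ m`, all blocks translation invariant) and
finiteness of the entries of `P⃗S, P⃗E, matB B, matAbar Ā, matBR B̄`: `x ↦ (Ξ x).toReal` is summable and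
`Σ_x (Ξ x).toReal ≤ P⃗Sℝ ⬝ᵥ (((matB B)ℝ^M * (matAbar Ā)ℝ * (matBR B̄)ℝ^m) *ᵥ P⃗Eℝ)`.  At `m = 0` the right side
is `P⃗Sℝ (matB B)ℝ^{N−1} (matAbar Ā)ℝ P⃗Eℝ`, the real form of the first display of (5.34)/(5.37).
[cite: FitznerVanDerHofstad2017, Prop. 5.5 (5.34), Prop. 5.6 (5.37), Lemma 6.1 (6.51) (arXiv:1506.07977v2 pp. 53, 66)] -/
theorem tsum_toReal_le_of_xSpaceBound [AddCommGroup G] [Fintype ι] [DecidableEq ι] [Fintype K]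
    {B A Bb : K → ι → ι → G → G → G → G → ℝ≥0∞} (hB : ∀ κ a b, IsTransInv (B κ a b))
    (hA : ∀ κ a b, IsTransInv (A κ a b)) (hBb : ∀ κ a b, IsTransInv (Bb κ a b)) (Ξ : G → ℝ≥0∞)
    (PS PE : ι → G → G → ℝ≥0∞) (M m : ℕ)
    (hΞ : ∀ x, Ξ x ≤ ∑' u, ∑' w, ∑' t, ∑' z, ∑ κ, ∑ a, ∑ b,
      recP PS B M a u w * A κ a b u w t z * recR PE Bb m b (z - x) (t - x))
    (hPS : ∀ a, vecP PS a ≠ ∞) (hPE : ∀ b, vecP PE b ≠ ∞) (hmB : ∀ a b, matB B a b ≠ ∞)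
    (hmA : ∀ a b, matAbar A a b ≠ ∞) (hmBb : ∀ a b, matBR Bb a b ≠ ∞) :
    Summable (fun x => (Ξ x).toReal) ∧
      ∑' x, (Ξ x).toReal ≤ (fun a => (vecP PS a).toReal) ⬝ᵥ
        (((matB B).map ENNReal.toReal ^ M * (matAbar A).map ENNReal.toReal * (matBR Bb).map ENNReal.toReal ^ m)
          *ᵥ fun b => (vecP PE b).toReal) :=
  summable_toReal_and_tsum_le hPS hPE hmB hmA hmBb M m (tsum_le_dotProduct_mulVec hB hA hBb Ξ PS PE M m hΞ)

end RealBound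

end Literature.Probability.FitznerVanDerHofstad2017.BlockSummation

end
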